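import Summits.QuantumFields.BalabanUV.Beta.D1BFx.ChartDefectTransportDefect
import Summits.QuantumFields.BalabanUV.Beta.D1BFx.ChartDefectWordsLiteral
import Summits.QuantumFields.BalabanUV.Beta.CombTablesAn1

/-!
# `BalabanUV.Beta.D1BFx.ChartDefectRetabledWords` — road «BF-x», binder row D1, RE-TABLE (an2 RULING R-D1-g55-1 (2)(4); `HOME/b2b-balaban-beta-d1-p2/RETABLE-SPEC-g28.md` §1∕§3):
# **THE RE-TABLED CHART DEFECT, WORD BY WORD — F6 INSTANTIATED AT THE RECORDS (the «δ-pin»), AND ITS ADDITIVE SPLIT `Δ_hyb + D_tab`.**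

THE OBJECT (§1 of the spec).  Literal (UNCHANGED): `T_s := TOf (JsB12CombShSym hodd N (symTablesAn1S2 3 n cΛ) cΛ cB 0) = hessKer G′ (vertexOfK G′ n S⁰_s) W⁰_s`
(`G′ := GcombSh n 0`, `(S⁰_s, W⁰_s) := ((JsB12CombSh0 … sym … 0).S, (…).W)`; `ChartDefectWordsLiteral.TOf_JsB12CombShSym_eq_hessKer_GcombSh`).  Re-tabled road, in the
END's shape (PART 22's `hC₁`, `RoadEndBFxCombS.d1Rep_BFx_comb_sbpS`): `T_c := hessKer G₀ (vertexOfK G₀ n S⁰_c) (vertex2OfK G₀ n S₂⁰_c)`, `G₀ := coDressKBmAt ρ_c n (KInvStep n 0)`,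
`S⁰_c := (JsB12CombSh0 hodd N (combTablesAn1S2 n hodd cΛ) cΛ cB 0).S`, `S₂⁰_c := n⁸ • wilsonW₂ 3 ((8N²)⁻¹ • wsym22 N) + cB • vh₂SAn1 n` (the COMB pair table).
* §1 (generic, any literal record `tabs`, any localised road pair `(Vc, Wc)` at `G₀`): `T_s − hessKer G₀ Vc Wc` = F6's transport-defect words with `Vs := vertexOfK G′ n S⁰`,
  `Ws := W⁰` — `ChartDefectTransportDefect.literal_sub_retabled_eq_transportDefect_words` ∘ the α-form; sockets: `loc_vertexOfK_of_spr spr_GcombSh_zero`, `loc_jetData_W`.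
* §2 (AT THE RECORDS — the δ-pin): the comb road's families ARE localised (`loc_vertexOfK_of_spr spr_G₀bm` on the comb datum's own `loc ∕ δ_pos`; `locStencil₂` of the comb pair
  table from an3's `biLoc_wilsonW₂` + the row's `SecondOrderTableLawEnd.locStencil₂_vh₂SAn1` + `locStencil₂_add' ∕ _smul'`; `loc_vertex2OfK_of_spr`), hence
  `retabledDefect_record_eq_transportDefect_words`: `T_s − T_c = ½·tadpole G₀ (δW) − ½·(bubble G₀ V_c δV + bubble G₀ δV V_c) − ½·bubble G₀ δV δV` with the TRANSPORT DEFECTS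
  `δV := Ψ̂ᵀ∘vertexOfK G′ n S⁰_s∘Ψ̂ − vertexOfK G₀ n S⁰_c`, `δW := Ψ̂ᵀ∘W⁰_s∘Ψ̂ − vertex2OfK G₀ n S₂⁰_c`, `Ψ̂ := psiKS (ctrOff 4 n) n` — the (J1) row's object under RE-TABLE is the
  (1.22) second moment of THIS word list (an2: «hC₁ = |secondMoment of the right side of F6| at Vs, Ws := the literal's; Vc, Wc := comb»).
* §3 (the ADDITIVE split, leaf-01 COUNT v4 §0 ∕ leaf-03 N-g36-1 §2 (c1)): `T_s − T_c = (T_s − T_hyb) + (T_hyb − T_c)` with `T_hyb := hessKer G₀ (vertexOfK G₀ n S⁰_s) (vertex2OfK G₀ n S₂⁰_s)`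
  (the hybrid road of record — `ChartDefectTwoPins.chartDefect_record_eq_words`' left side, the 5-row HEAD `ChartDefectHeadRepaired`), and the TABLE part `D_tab := T_hyb − T_c` at ONE kernel:
  `tab_defect_record_eq_words` = `hessKer_add_add_sub` at `G₀` with `δ_tV := vertexOfK G₀ n S⁰_s − vertexOfK G₀ n S⁰_c`, `δ_tW := vertex2OfK G₀ n S₂⁰_s − vertex2OfK G₀ n S₂⁰_c` — no `E`, no `Dsh`,
  one leg.  (That `δ_tV`, `δ_tW` are `vertexOfK ∕ vertex2OfK` of the border-table DIFFERENCES — the Wilson letters cancel by `JsB12CombSh0_S_zero` — is the summable-linearity remark of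
  the spec §3 (A2); not needed here and not typed here.)
NOTHING IS PRICED: identities between OUR kernels composed BY NAME; the by-value size and n-law of either side are the row's condition (B) ∕ the road's (B2′), not this file's.

HONEST DEPENDENCY (cell records, verbatim): «continuum YM on T⁴ ⇐ BetaPertH ∧ nine spine estimates (0/9 proved); BetaPertH ⇐ (D1) ∧ (D4) ∧
CAP+tail; G-an2-4 gates asym, D1 and NE2/3/4.»  HONEST FRAMING (cell contract, verbatim): «discharging `BetaPertH` makes Bałaban's UV stability
UNCONDITIONAL — a real constructive-QFT result; it is NOT the continuum limit and NOT the Clay problem.»  THIS MODULE DISCHARGES NOTHING of the wall: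
[folklore] instances BY NAME of two [our object] identities (F6, `hessKer_add_add_sub`) + locality bookkeeping; no definition, no `def … : Prop`, nothing cited,
0 sorry, default heartbeats.  0∕4 row-D1 binders (hW ∕ hR ∕ D1Tel ∕ D1Rep); (K) NOT closed; (J1) ONE OPEN ROW (direction RE-TABLE FINAL, viability (B) by value);
NOT D1, NEVER «G-an2-4 closed», NOT `BetaPertH`, NOT continuum, NOT Clay.

ABSOLUTE RULE (cell charter, verbatim): «No internally-minted statement may enter as a cited fact. Every hypothesis is either kernel-proved in this
package or a verbatim quotation of a PUBLISHED theorem with page reference. The manuscript(s) under audit are NOT citable for their own disputed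
steps — they are the thing under adjudication; programme-internal (2001/route/tribunal) claims are never citable.»

Unit `b2b-balaban-beta-d1-p2` (road owner, gen 28), 2026-08-25; no existing file touched.
-/

noncomputable section

namespace Summit.QuantumFields.BalabanUV.Beta.D1BFx.ChartDefectRetabledWords

open Literature.MathematicalPhysics.QuantumFieldTheory.Balaban1983to89
open Literature.MathematicalPhysics.QuantumFieldTheory.Balaban1983to89.Beta
open ExpKernelCalculus (MKer comp tadpole bubble hessKer)
open OneStepResolventKernel (Fib TOf LocStencil)
open OneStepKernelFamily (KInvStep vertexOfK)
open SecondOrderResponse (vertex2OfK)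
open BalabanCompositeJets (LocStencil₂)
open BalabanStepW2 (locStencil₂_add' locStencil₂_smul')
open WilsonVertex2Sym (wsym22)
open WilsonBiStencil (wilsonW₂ wBound₂ biLoc_wilsonW₂)
open AffineAveraging (box toSite)
open AveragingContoursRooted (ctr ctrOff ctrOff_mem_box)
open Summit.QuantumFields.BalabanUV.Beta.TameKernelCalculus
open Summit.QuantumFields.BalabanUV.Beta.AxialDressingRooted (coDressKBmAt)
open Summit.QuantumFields.BalabanUV.Beta.SymmetrisedStepJets (SymTables)
open Summit.QuantumFields.BalabanUV.Beta.CombChartStepJets (GcombSh JsB12CombSh0)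
open Summit.QuantumFields.BalabanUV.Beta.CombChartJointEnd (JsB12CombShSym)
open Summit.QuantumFields.BalabanUV.Beta.SymSecondOrderTablesAn1 (symVh₂SAn1 symTablesAn1S2)
open Summit.QuantumFields.BalabanUV.Beta.CombTablesAn1 (combTablesAn1S2)
open Summit.QuantumFields.BalabanUV.Beta.SecondOrderSocketIdentification (vh₂SAn1)
open Summit.QuantumFields.BalabanUV.Beta.SecondOrderTableLawEnd (locStencil₂_vh₂SAn1)
open Summit.QuantumFields.BalabanUV.Beta.SymCorrectorKernel (psiKS)
open Summit.QuantumFields.BalabanUV.Beta.D1BFx.ChartDefectResolvent (spr_G0bm_ctr spr_GcombSh_zero)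
open Summit.QuantumFields.BalabanUV.Beta.D1BFx.HessKerConjugation (hessKer_add_add_sub)
open Summit.QuantumFields.BalabanUV.Beta.D1BFx.ChartDefectWords (loc_vertexOfK_of_spr loc_jetData_W loc_vertex2OfK_of_spr)
open Summit.QuantumFields.BalabanUV.Beta.D1BFx.ChartDefectWordsLiteral (TOf_JsB12CombShSym_eq_hessKer_GcombSh)
open Summit.QuantumFields.BalabanUV.Beta.D1BFx.ChartDefectTransportDefect (literal_sub_retabled_eq_transportDefect_words)

variable {n : ℕ} [NeZero n]

/-! ## §0 Locality sockets of the literal's and the re-tabled road's families -/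

section Sockets

/-- [folklore] The literal's own chain-rule vertex `vertexOfK G′ n S⁰` (ANY table record) is localised. -/
theorem loc_vertexOfK_GcombSh (hodd : Odd n) (N : ℕ) (tabs : SymTables 3 n) (cΛ cB : ℝ) (μ : Fin 4) (y : Fin 4 → ℤ) :
    Loc (vertexOfK (GcombSh (d := 3) n 0) n (JsB12CombSh0 hodd N tabs cΛ cB 0).S μ y) :=
  loc_vertexOfK_of_spr (spr_GcombSh_zero (d := 3) (Lc := n)) (JsB12CombSh0 hodd N tabs cΛ cB 0).loc (JsB12CombSh0 hodd N tabs cΛ cB 0).δ_pos μ y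

/-- [folklore] The road's chain-rule vertex `vertexOfK G₀ n S⁰` (ANY table record) is localised. -/
theorem loc_vertexOfK_G0bm (hodd : Odd n) (N : ℕ) (tabs : SymTables 3 n) (cΛ cB : ℝ) (μ : Fin 4) (y : Fin 4 → ℤ) :
    Loc (vertexOfK (coDressKBmAt (ctr 4 n) n (KInvStep (d := 3) n 0)) n (JsB12CombSh0 hodd N tabs cΛ cB 0).S μ y) :=
  loc_vertexOfK_of_spr (spr_G0bm_ctr (d := 3) (Lc := n)) (JsB12CombSh0 hodd N tabs cΛ cB 0).loc (JsB12CombSh0 hodd N tabs cΛ cB 0).δ_pos μ y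

omit [NeZero n] in
/-- [folklore] **THE COMB PAIR TABLE IS A `LocStencil₂` FAMILY** (`n` odd): `n⁸ • wilsonW₂ 3 T + cB • vh₂SAn1 n` — an3's `biLoc_wilsonW₂` + the row's `locStencil₂_vh₂SAn1`. -/
theorem locStencil₂_combPairTable (hodd : Odd n) (T : Fin 4 → Fin 4 → Fin 4 → Fin 4 → ℝ) (cE₂ cB : ℝ) :
    ∃ C δ : ℝ, 0 ≤ C ∧ 0 < δ ∧ LocStencil₂ (fun κ u κ' u' => cE₂ • wilsonW₂ 3 T κ u κ' u' + cB • vh₂SAn1 n κ u κ' u') C δ := by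
  obtain ⟨CB, δB, hδB, hBl⟩ := locStencil₂_vh₂SAn1 hodd
  have hWil : LocStencil₂ (wilsonW₂ 3 T) (wBound₂ 3 T * Real.exp (8 * δB)) δB := fun κ u κ' u' => biLoc_wilsonW₂ T hδB.le κ u κ' u'
  have h := locStencil₂_add' (locStencil₂_smul' cE₂ hWil) (locStencil₂_smul' cB hBl)
  have h0 := (h 0 0 0 0).nonneg (Sum.inl 0)
  rw [sub_self, BalabanCompositeJets.l1_zero', mul_zero, Real.exp_zero, mul_one] at h0
  exact ⟨_, δB, h0, hδB, h⟩

/-- [folklore] The sym pair table of the hybrid road is a `LocStencil₂` family (same proof at `symVh₂SAn1 3 n`; `n ≥ 1`). -/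
theorem locStencil₂_symPairTable (T : Fin 4 → Fin 4 → Fin 4 → Fin 4 → ℝ) (cE₂ cB : ℝ) :
    ∃ C δ : ℝ, 0 ≤ C ∧ 0 < δ ∧ LocStencil₂ (fun κ u κ' u' => cE₂ • wilsonW₂ 3 T κ u κ' u' + cB • symVh₂SAn1 3 n κ u κ' u') C δ := by
  obtain ⟨CB, δB, hδB, hBl⟩ := SymSecondOrderTablesAn1.locStencil₂_symVh₂SAn1 (d := 3) (AxialDressingRooted.one_le_of_neZero n)
  have hWil : LocStencil₂ (wilsonW₂ 3 T) (wBound₂ 3 T * Real.exp (8 * δB)) δB := fun κ u κ' u' => biLoc_wilsonW₂ T hδB.le κ u κ' u'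
  have h := locStencil₂_add' (locStencil₂_smul' cE₂ hWil) (locStencil₂_smul' cB hBl)
  have h0 := (h 0 0 0 0).nonneg (Sum.inl 0)
  rw [sub_self, BalabanCompositeJets.l1_zero', mul_zero, Real.exp_zero, mul_one] at h0
  exact ⟨_, δB, h0, hδB, h⟩

/-- [folklore] The road's pair vertex at the COMB pair table is localised. -/
theorem loc_vertex2OfK_G0bm_comb (hodd : Odd n) (N : ℕ) (cB : ℝ) (μ : Fin 4) (y : Fin 4 → ℤ) (ν : Fin 4) (y' : Fin 4 → ℤ) :
    Loc (vertex2OfK (coDressKBmAt (ctr 4 n) n (KInvStep (d := 3) n 0)) n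
      (fun κ u κ' u' => ((n : ℝ) ^ 8) • wilsonW₂ 3 ((8 * (N : ℝ) ^ 2)⁻¹ • wsym22 N) κ u κ' u' + cB • vh₂SAn1 n κ u κ' u') μ y ν y') := by
  obtain ⟨C, δ, hC, hδ, h⟩ := locStencil₂_combPairTable hodd ((8 * (N : ℝ) ^ 2)⁻¹ • wsym22 N) ((n : ℝ) ^ 8) cB
  exact loc_vertex2OfK_of_spr (spr_G0bm_ctr (d := 3) (Lc := n)) h hC hδ μ y ν y'

/-- [folklore] The hybrid road's pair vertex at the SYM pair table is localised. -/
theorem loc_vertex2OfK_G0bm_sym (N : ℕ) (cB : ℝ) (μ : Fin 4) (y : Fin 4 → ℤ) (ν : Fin 4) (y' : Fin 4 → ℤ) :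
    Loc (vertex2OfK (coDressKBmAt (ctr 4 n) n (KInvStep (d := 3) n 0)) n
      (fun κ u κ' u' => ((n : ℝ) ^ 8) • wilsonW₂ 3 ((8 * (N : ℝ) ^ 2)⁻¹ • wsym22 N) κ u κ' u' + cB • symVh₂SAn1 3 n κ u κ' u') μ y ν y') := by
  obtain ⟨C, δ, hC, hδ, h⟩ := locStencil₂_symPairTable (n := n) ((8 * (N : ℝ) ^ 2)⁻¹ • wsym22 N) ((n : ℝ) ^ 8) cB
  exact loc_vertex2OfK_of_spr (spr_G0bm_ctr (d := 3) (Lc := n)) h hC hδ μ y ν y'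

end Sockets

/-! ## §1 The literal of ANY record against ANY localised road pair at `G₀`: F6's words (α-form ∘ F6) -/

/-- [folklore] **THE LITERAL MINUS A ROAD AT `G₀`, AS TRANSPORT-DEFECT WORDS** (any literal record `tabs`; any localised `Vc`, `Wc`):
`TOf (JsB12CombShSym hodd N tabs cΛ cB 0) μ ν z − hessKer G₀ Vc Wc μ ν z = ½·tadpole G₀ (δW μ0νz) − ½·(bubble G₀ (Vc μ0) (δV νz) + bubble G₀ (δV μ0) (Vc νz)) − ½·bubble G₀ (δV μ0) (δV νz)`,
`δV := Ψ̂ᵀ∘vertexOfK G′ n S⁰∘Ψ̂ − Vc`, `δW := Ψ̂ᵀ∘W⁰∘Ψ̂ − Wc` (`ChartDefectWordsLiteral.TOf_JsB12CombShSym_eq_hessKer_GcombSh`, then F6). -/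
theorem literal_sub_roadAt_eq_transportDefect_words (hodd : Odd n) (N : ℕ) (tabs : SymTables 3 n) (cΛ cB : ℝ)
    {Vc : Fin 4 → (Fin 4 → ℤ) → MKer 4 (Fib 3)} {Wc : Fin 4 → (Fin 4 → ℤ) → Fin 4 → (Fin 4 → ℤ) → MKer 4 (Fib 3)}
    (hVc : ∀ μ y, Loc (Vc μ y)) (hWc : ∀ μ y ν y', Loc (Wc μ y ν y')) (μ ν : Fin 4) (z : Fin 4 → ℤ) :
    TOf (N := n) (JsB12CombShSym hodd N tabs cΛ cB 0) μ ν z - hessKer (coDressKBmAt (ctr 4 n) n (KInvStep (d := 3) n 0)) Vc Wc μ ν z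
      = (1 / 2) * tadpole (coDressKBmAt (ctr 4 n) n (KInvStep (d := 3) n 0))
            (comp (comp (trK (psiKS (ctrOff 4 n) n)) ((JsB12CombSh0 hodd N tabs cΛ cB 0).W μ 0 ν z)) (psiKS (ctrOff 4 n) n) - Wc μ 0 ν z)
        - (1 / 2) * (bubble (coDressKBmAt (ctr 4 n) n (KInvStep (d := 3) n 0)) (Vc μ 0)
                (comp (comp (trK (psiKS (ctrOff 4 n) n)) (vertexOfK (GcombSh (d := 3) n 0) n (JsB12CombSh0 hodd N tabs cΛ cB 0).S ν z)) (psiKS (ctrOff 4 n) n) - Vc ν z)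
            + bubble (coDressKBmAt (ctr 4 n) n (KInvStep (d := 3) n 0))
                (comp (comp (trK (psiKS (ctrOff 4 n) n)) (vertexOfK (GcombSh (d := 3) n 0) n (JsB12CombSh0 hodd N tabs cΛ cB 0).S μ 0)) (psiKS (ctrOff 4 n) n) - Vc μ 0) (Vc ν z))
        - (1 / 2) * bubble (coDressKBmAt (ctr 4 n) n (KInvStep (d := 3) n 0))
            (comp (comp (trK (psiKS (ctrOff 4 n) n)) (vertexOfK (GcombSh (d := 3) n 0) n (JsB12CombSh0 hodd N tabs cΛ cB 0).S μ 0)) (psiKS (ctrOff 4 n) n) - Vc μ 0)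
            (comp (comp (trK (psiKS (ctrOff 4 n) n)) (vertexOfK (GcombSh (d := 3) n 0) n (JsB12CombSh0 hodd N tabs cΛ cB 0).S ν z)) (psiKS (ctrOff 4 n) n) - Vc ν z) := by
  rw [TOf_JsB12CombShSym_eq_hessKer_GcombSh n hodd N tabs cΛ cB]
  exact literal_sub_retabled_eq_transportDefect_words (d := 3) n (loc_vertexOfK_GcombSh hodd N tabs cΛ cB) hVc
    (loc_jetData_W (JsB12CombSh0 hodd N tabs cΛ cB 0)) hWc μ ν z

/-! ## §2 AT THE RECORDS: the literal of an1's (0.4) record minus the RE-TABLED road (comb record, END shape) — the δ-pin -/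

/-- **THE RE-TABLED CHART DEFECT, WORD BY WORD (the δ-pin)** [our object ∕ folklore].  `n` odd, lockB free (`cB`); literal `TOf (JsB12CombShSym hodd N (symTablesAn1S2 3 n cΛ) cΛ cB 0)`;
re-tabled road `hessKer G₀ (vertexOfK G₀ n S⁰_c) (vertex2OfK G₀ n S₂⁰_c)`, `S⁰_c := (JsB12CombSh0 hodd N (combTablesAn1S2 n hodd cΛ) cΛ cB 0).S`, `S₂⁰_c := n⁸ • wilsonW₂ 3 ((8N²)⁻¹ • wsym22 N) + cB • vh₂SAn1 n`:
their difference IS F6's transport-defect word list with `δV := Ψ̂ᵀ∘vertexOfK G′ n S⁰_s∘Ψ̂ − vertexOfK G₀ n S⁰_c`, `δW := Ψ̂ᵀ∘W⁰_s∘Ψ̂ − vertex2OfK G₀ n S₂⁰_c`.  The (J1) row's object under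
RE-TABLE (R-D1-g55-1 (2)) is the (1.22) second moment of the left side; nothing here prices it. -/
theorem retabledDefect_record_eq_transportDefect_words (hodd : Odd n) (N : ℕ) (cΛ cB : ℝ) (μ ν : Fin 4) (z : Fin 4 → ℤ) :
    TOf (N := n) (JsB12CombShSym hodd N (symTablesAn1S2 3 n cΛ) cΛ cB 0) μ ν z
        - hessKer (coDressKBmAt (ctr 4 n) n (KInvStep (d := 3) n 0))
            (vertexOfK (coDressKBmAt (ctr 4 n) n (KInvStep (d := 3) n 0)) n (JsB12CombSh0 hodd N (combTablesAn1S2 n hodd cΛ) cΛ cB 0).S)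
            (vertex2OfK (coDressKBmAt (ctr 4 n) n (KInvStep (d := 3) n 0)) n
              (fun κ u κ' u' => ((n : ℝ) ^ 8) • wilsonW₂ 3 ((8 * (N : ℝ) ^ 2)⁻¹ • wsym22 N) κ u κ' u' + cB • vh₂SAn1 n κ u κ' u')) μ ν z
      = (1 / 2) * tadpole (coDressKBmAt (ctr 4 n) n (KInvStep (d := 3) n 0))
            (comp (comp (trK (psiKS (ctrOff 4 n) n)) ((JsB12CombSh0 hodd N (symTablesAn1S2 3 n cΛ) cΛ cB 0).W μ 0 ν z)) (psiKS (ctrOff 4 n) n)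
              - vertex2OfK (coDressKBmAt (ctr 4 n) n (KInvStep (d := 3) n 0)) n
                  (fun κ u κ' u' => ((n : ℝ) ^ 8) • wilsonW₂ 3 ((8 * (N : ℝ) ^ 2)⁻¹ • wsym22 N) κ u κ' u' + cB • vh₂SAn1 n κ u κ' u') μ 0 ν z)
        - (1 / 2) * (bubble (coDressKBmAt (ctr 4 n) n (KInvStep (d := 3) n 0))
                (vertexOfK (coDressKBmAt (ctr 4 n) n (KInvStep (d := 3) n 0)) n (JsB12CombSh0 hodd N (combTablesAn1S2 n hodd cΛ) cΛ cB 0).S μ 0)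
                (comp (comp (trK (psiKS (ctrOff 4 n) n)) (vertexOfK (GcombSh (d := 3) n 0) n (JsB12CombSh0 hodd N (symTablesAn1S2 3 n cΛ) cΛ cB 0).S ν z)) (psiKS (ctrOff 4 n) n)
                  - vertexOfK (coDressKBmAt (ctr 4 n) n (KInvStep (d := 3) n 0)) n (JsB12CombSh0 hodd N (combTablesAn1S2 n hodd cΛ) cΛ cB 0).S ν z)
            + bubble (coDressKBmAt (ctr 4 n) n (KInvStep (d := 3) n 0))
                (comp (comp (trK (psiKS (ctrOff 4 n) n)) (vertexOfK (GcombSh (d := 3) n 0) n (JsB12CombSh0 hodd N (symTablesAn1S2 3 n cΛ) cΛ cB 0).S μ 0)) (psiKS (ctrOff 4 n) n)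
                  - vertexOfK (coDressKBmAt (ctr 4 n) n (KInvStep (d := 3) n 0)) n (JsB12CombSh0 hodd N (combTablesAn1S2 n hodd cΛ) cΛ cB 0).S μ 0)
                (vertexOfK (coDressKBmAt (ctr 4 n) n (KInvStep (d := 3) n 0)) n (JsB12CombSh0 hodd N (combTablesAn1S2 n hodd cΛ) cΛ cB 0).S ν z))
        - (1 / 2) * bubble (coDressKBmAt (ctr 4 n) n (KInvStep (d := 3) n 0))
            (comp (comp (trK (psiKS (ctrOff 4 n) n)) (vertexOfK (GcombSh (d := 3) n 0) n (JsB12CombSh0 hodd N (symTablesAn1S2 3 n cΛ) cΛ cB 0).S μ 0)) (psiKS (ctrOff 4 n) n)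
              - vertexOfK (coDressKBmAt (ctr 4 n) n (KInvStep (d := 3) n 0)) n (JsB12CombSh0 hodd N (combTablesAn1S2 n hodd cΛ) cΛ cB 0).S μ 0)
            (comp (comp (trK (psiKS (ctrOff 4 n) n)) (vertexOfK (GcombSh (d := 3) n 0) n (JsB12CombSh0 hodd N (symTablesAn1S2 3 n cΛ) cΛ cB 0).S ν z)) (psiKS (ctrOff 4 n) n)
              - vertexOfK (coDressKBmAt (ctr 4 n) n (KInvStep (d := 3) n 0)) n (JsB12CombSh0 hodd N (combTablesAn1S2 n hodd cΛ) cΛ cB 0).S ν z) :=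
  literal_sub_roadAt_eq_transportDefect_words hodd N (symTablesAn1S2 3 n cΛ) cΛ cB (loc_vertexOfK_G0bm hodd N (combTablesAn1S2 n hodd cΛ) cΛ cB)
    (loc_vertex2OfK_G0bm_comb hodd N cB) μ ν z

/-! ## §3 The additive split `T_s − T_c = Δ_hyb + D_tab` and the table part word by word at ONE kernel -/

/-- [folklore] **THE ADDITIVE PRESENTATION**: literal − re-tabled road = (literal − hybrid road) + (hybrid road − re-tabled road), pointwise (`ring`). The first bracket is
`ChartDefectTwoPins.chartDefect_record_eq_words`' left side (lockB `cB = −n¹²∕4` there); the second is `tab_defect_record_eq_words` below. -/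
theorem retabledDefect_eq_hyb_add_tab (hodd : Odd n) (N : ℕ) (cΛ cB : ℝ) (μ ν : Fin 4) (z : Fin 4 → ℤ) :
    TOf (N := n) (JsB12CombShSym hodd N (symTablesAn1S2 3 n cΛ) cΛ cB 0) μ ν z
        - hessKer (coDressKBmAt (ctr 4 n) n (KInvStep (d := 3) n 0))
            (vertexOfK (coDressKBmAt (ctr 4 n) n (KInvStep (d := 3) n 0)) n (JsB12CombSh0 hodd N (combTablesAn1S2 n hodd cΛ) cΛ cB 0).S)
            (vertex2OfK (coDressKBmAt (ctr 4 n) n (KInvStep (d := 3) n 0)) n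
              (fun κ u κ' u' => ((n : ℝ) ^ 8) • wilsonW₂ 3 ((8 * (N : ℝ) ^ 2)⁻¹ • wsym22 N) κ u κ' u' + cB • vh₂SAn1 n κ u κ' u')) μ ν z
      = (TOf (N := n) (JsB12CombShSym hodd N (symTablesAn1S2 3 n cΛ) cΛ cB 0) μ ν z
          - hessKer (coDressKBmAt (ctr 4 n) n (KInvStep (d := 3) n 0))
              (vertexOfK (coDressKBmAt (ctr 4 n) n (KInvStep (d := 3) n 0)) n (JsB12CombSh0 hodd N (symTablesAn1S2 3 n cΛ) cΛ cB 0).S)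
              (vertex2OfK (coDressKBmAt (ctr 4 n) n (KInvStep (d := 3) n 0)) n
                (fun κ u κ' u' => ((n : ℝ) ^ 8) • wilsonW₂ 3 ((8 * (N : ℝ) ^ 2)⁻¹ • wsym22 N) κ u κ' u' + cB • symVh₂SAn1 3 n κ u κ' u')) μ ν z)
        + (hessKer (coDressKBmAt (ctr 4 n) n (KInvStep (d := 3) n 0))
              (vertexOfK (coDressKBmAt (ctr 4 n) n (KInvStep (d := 3) n 0)) n (JsB12CombSh0 hodd N (symTablesAn1S2 3 n cΛ) cΛ cB 0).S)
              (vertex2OfK (coDressKBmAt (ctr 4 n) n (KInvStep (d := 3) n 0)) n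
                (fun κ u κ' u' => ((n : ℝ) ^ 8) • wilsonW₂ 3 ((8 * (N : ℝ) ^ 2)⁻¹ • wsym22 N) κ u κ' u' + cB • symVh₂SAn1 3 n κ u κ' u')) μ ν z
          - hessKer (coDressKBmAt (ctr 4 n) n (KInvStep (d := 3) n 0))
              (vertexOfK (coDressKBmAt (ctr 4 n) n (KInvStep (d := 3) n 0)) n (JsB12CombSh0 hodd N (combTablesAn1S2 n hodd cΛ) cΛ cB 0).S)
              (vertex2OfK (coDressKBmAt (ctr 4 n) n (KInvStep (d := 3) n 0)) n
                (fun κ u κ' u' => ((n : ℝ) ^ 8) • wilsonW₂ 3 ((8 * (N : ℝ) ^ 2)⁻¹ • wsym22 N) κ u κ' u' + cB • vh₂SAn1 n κ u κ' u')) μ ν z) := by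
  ring

/-- [folklore] **THE TABLE PART `D_tab` WORD BY WORD AT ONE KERNEL** (`hessKer_add_add_sub` at `G₀`): hybrid road − re-tabled road
`= ½·tadpole G₀ (δ_tW μ0νz) − ½·(bubble G₀ (V_c μ0) (δ_tV νz) + bubble G₀ (δ_tV μ0) (V_c νz)) − ½·bubble G₀ (δ_tV μ0) (δ_tV νz)`, `V_c := vertexOfK G₀ n S⁰_c`,
`δ_tV := vertexOfK G₀ n S⁰_s − V_c`, `δ_tW := vertex2OfK G₀ n S₂⁰_s − vertex2OfK G₀ n S₂⁰_c` — no corrector, no border insertion, one leg. -/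
theorem tab_defect_record_eq_words (hodd : Odd n) (N : ℕ) (cΛ cB : ℝ) (μ ν : Fin 4) (z : Fin 4 → ℤ) :
    hessKer (coDressKBmAt (ctr 4 n) n (KInvStep (d := 3) n 0))
          (vertexOfK (coDressKBmAt (ctr 4 n) n (KInvStep (d := 3) n 0)) n (JsB12CombSh0 hodd N (symTablesAn1S2 3 n cΛ) cΛ cB 0).S)
          (vertex2OfK (coDressKBmAt (ctr 4 n) n (KInvStep (d := 3) n 0)) n
            (fun κ u κ' u' => ((n : ℝ) ^ 8) • wilsonW₂ 3 ((8 * (N : ℝ) ^ 2)⁻¹ • wsym22 N) κ u κ' u' + cB • symVh₂SAn1 3 n κ u κ' u')) μ ν z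
        - hessKer (coDressKBmAt (ctr 4 n) n (KInvStep (d := 3) n 0))
            (vertexOfK (coDressKBmAt (ctr 4 n) n (KInvStep (d := 3) n 0)) n (JsB12CombSh0 hodd N (combTablesAn1S2 n hodd cΛ) cΛ cB 0).S)
            (vertex2OfK (coDressKBmAt (ctr 4 n) n (KInvStep (d := 3) n 0)) n
              (fun κ u κ' u' => ((n : ℝ) ^ 8) • wilsonW₂ 3 ((8 * (N : ℝ) ^ 2)⁻¹ • wsym22 N) κ u κ' u' + cB • vh₂SAn1 n κ u κ' u')) μ ν z
      = (1 / 2) * tadpole (coDressKBmAt (ctr 4 n) n (KInvStep (d := 3) n 0))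
            (vertex2OfK (coDressKBmAt (ctr 4 n) n (KInvStep (d := 3) n 0)) n
                (fun κ u κ' u' => ((n : ℝ) ^ 8) • wilsonW₂ 3 ((8 * (N : ℝ) ^ 2)⁻¹ • wsym22 N) κ u κ' u' + cB • symVh₂SAn1 3 n κ u κ' u') μ 0 ν z
              - vertex2OfK (coDressKBmAt (ctr 4 n) n (KInvStep (d := 3) n 0)) n
                (fun κ u κ' u' => ((n : ℝ) ^ 8) • wilsonW₂ 3 ((8 * (N : ℝ) ^ 2)⁻¹ • wsym22 N) κ u κ' u' + cB • vh₂SAn1 n κ u κ' u') μ 0 ν z)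
        - (1 / 2) * (bubble (coDressKBmAt (ctr 4 n) n (KInvStep (d := 3) n 0))
                (vertexOfK (coDressKBmAt (ctr 4 n) n (KInvStep (d := 3) n 0)) n (JsB12CombSh0 hodd N (combTablesAn1S2 n hodd cΛ) cΛ cB 0).S μ 0)
                (vertexOfK (coDressKBmAt (ctr 4 n) n (KInvStep (d := 3) n 0)) n (JsB12CombSh0 hodd N (symTablesAn1S2 3 n cΛ) cΛ cB 0).S ν z
                  - vertexOfK (coDressKBmAt (ctr 4 n) n (KInvStep (d := 3) n 0)) n (JsB12CombSh0 hodd N (combTablesAn1S2 n hodd cΛ) cΛ cB 0).S ν z)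
            + bubble (coDressKBmAt (ctr 4 n) n (KInvStep (d := 3) n 0))
                (vertexOfK (coDressKBmAt (ctr 4 n) n (KInvStep (d := 3) n 0)) n (JsB12CombSh0 hodd N (symTablesAn1S2 3 n cΛ) cΛ cB 0).S μ 0
                  - vertexOfK (coDressKBmAt (ctr 4 n) n (KInvStep (d := 3) n 0)) n (JsB12CombSh0 hodd N (combTablesAn1S2 n hodd cΛ) cΛ cB 0).S μ 0)
                (vertexOfK (coDressKBmAt (ctr 4 n) n (KInvStep (d := 3) n 0)) n (JsB12CombSh0 hodd N (combTablesAn1S2 n hodd cΛ) cΛ cB 0).S ν z))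
        - (1 / 2) * bubble (coDressKBmAt (ctr 4 n) n (KInvStep (d := 3) n 0))
            (vertexOfK (coDressKBmAt (ctr 4 n) n (KInvStep (d := 3) n 0)) n (JsB12CombSh0 hodd N (symTablesAn1S2 3 n cΛ) cΛ cB 0).S μ 0
              - vertexOfK (coDressKBmAt (ctr 4 n) n (KInvStep (d := 3) n 0)) n (JsB12CombSh0 hodd N (combTablesAn1S2 n hodd cΛ) cΛ cB 0).S μ 0)
            (vertexOfK (coDressKBmAt (ctr 4 n) n (KInvStep (d := 3) n 0)) n (JsB12CombSh0 hodd N (symTablesAn1S2 3 n cΛ) cΛ cB 0).S ν z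
              - vertexOfK (coDressKBmAt (ctr 4 n) n (KInvStep (d := 3) n 0)) n (JsB12CombSh0 hodd N (combTablesAn1S2 n hodd cΛ) cΛ cB 0).S ν z) := by
  -- abbreviations: the road kernel, the two first-order and the two pair families
  set G₀ := coDressKBmAt (ctr 4 n) n (KInvStep (d := 3) n 0) with hG₀
  set Vs := vertexOfK G₀ n (JsB12CombSh0 hodd N (symTablesAn1S2 3 n cΛ) cΛ cB 0).S with hVs
  set Vc := vertexOfK G₀ n (JsB12CombSh0 hodd N (combTablesAn1S2 n hodd cΛ) cΛ cB 0).S with hVc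
  set Ws := vertex2OfK G₀ n (fun κ u κ' u' => ((n : ℝ) ^ 8) • wilsonW₂ 3 ((8 * (N : ℝ) ^ 2)⁻¹ • wsym22 N) κ u κ' u' + cB • symVh₂SAn1 3 n κ u κ' u') with hWs
  set Wc := vertex2OfK G₀ n (fun κ u κ' u' => ((n : ℝ) ^ 8) • wilsonW₂ 3 ((8 * (N : ℝ) ^ 2)⁻¹ • wsym22 N) κ u κ' u' + cB • vh₂SAn1 n κ u κ' u') with hWc
  have hVcl : ∀ μ y, Loc (Vc μ y) := loc_vertexOfK_G0bm hodd N (combTablesAn1S2 n hodd cΛ) cΛ cB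
  have hVsl : ∀ μ y, Loc (Vs μ y) := loc_vertexOfK_G0bm hodd N (symTablesAn1S2 3 n cΛ) cΛ cB
  have hWcl : ∀ μ y ν y', Loc (Wc μ y ν y') := loc_vertex2OfK_G0bm_comb hodd N cB
  have hWsl : ∀ μ y ν y', Loc (Ws μ y ν y') := loc_vertex2OfK_G0bm_sym (n := n) N cB
  -- hybrid families = comb families + differences (pointwise)
  have eV : Vs = Vc + fun μ y => Vs μ y - Vc μ y := by funext μ y; simp only [Pi.add_apply, add_sub_cancel]
  have eW : Ws = Wc + fun μ y ν y' => Ws μ y ν y' - Wc μ y ν y' := by funext μ y ν y'; simp only [Pi.add_apply, add_sub_cancel]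
  have h := hessKer_add_add_sub (spr_G0bm_ctr (d := 3) (Lc := n)) hVcl (fun μ y => (hVsl μ y).sub (hVcl μ y)) hWcl
    (fun μ y ν y' => (hWsl μ y ν y').sub (hWcl μ y ν y')) μ ν z
  rw [← eV, ← eW] at h
  exact h

end Summit.QuantumFields.BalabanUV.Beta.D1BFx.ChartDefectRetabledWords

end
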